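import Literature.MathematicalPhysics.QuantumFieldTheory.Balaban1983to89.B9Eq326DeltaALocalityZd
import Literature.MathematicalPhysics.QuantumFieldTheory.Balaban1983to89.B8Ineq159CurvedCubeMemberReads

/-!
# `Balaban1983to89.B9Eq326DeltaALocalityZdSides` — [Balaban1985BackgroundPropagators] (3.26)–(3.27) p. 395 at the `ℤᵈ × 𝔸` carrier: THE GENUINE FOUR-LETTER
# `Δ_a(U₀)` RESTRICTED TO `E(Ω₀)` READS THE BACKGROUND ONLY ON THE SIDES OF THE PLAQUETTES TOUCHING `Ω₀` (p. 77's convention) — the sharp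
# re-keying of `B9Eq326DeltaALocalityZd` (which read ℓ∞-unit balls); at a cube member, `RegularAtH` ∕ `RegularAt` ∕ `HermPreservingAt` ∕ the form
# `⟨A, Δ_a(U₀)A⟩_τ` of `opsAllZd` transfer between unitary backgrounds agreeing on `SideTouches (i.Ω 0)`

statement-level skeleton of published theorems with citation tags; proofs where landed; nothing here is a claim about the
Yang–Mills mass gap

T. Bałaban, *Propagators for lattice gauge theories in a background field*, Commun. Math. Phys. **99** (1985) 389–434 [`Balaban1985BackgroundPropagators`,
"B9"], journal page = PDF page + 388: (3.10) p. 392 (the curvature letter `Δ′(U)`; (3.69) p. 404 «bonds belonging to one of the plaquettes containing the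
bond b»), (3.16) p. 393 (`Q*aQ`), (3.20)–(3.26) pp. 394–395 (`R(U₀)`, `D R D*`, `Δ_a`), (3.27) p. 395 (`G(U₀) = (Ω₀Δ_aΩ₀)⁻¹`), Thm 3.11 p. 416.
[`Balaban1985RegularSpaces`, "B8"] p. 77 («we denote by `Ω` also the set of bonds … Similarly for the corresponding set of plaquettes» — the TOUCHING
convention; (1.7) the class `𝔄_k({Ω_j}, α₀)`), (1.2) p. 76 (the sides of `p_{μν}(x)`), (1.131) p. 99 (the cube member). [`Balaban1985Averaging`, "B7"] p. 24
(after (43)) «this definition is local».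

CITATION HEADER ∕ WHY THIS FILE (cell `pub-ymgap`, HUMAN RULING D-0062; seat `pub-ymgap-dag-n06-b` (g20), node N06 = [B9]; the binder∕letter owner of the
junction J-N06→N05).  The per-member Theorem 3.11 of this lineage (`B9Thm311PerMemberCubeZdUnconditional`, g19) concludes at every unitary background whose
plaquette variables are small on the BOX `□₀ ± 3`, because its locality input `B9Eq326DeltaALocalityZd.regular_opsAllZd_congr_cube` was keyed on that box.
The junction's DATUM, however, is a background of [B8]'s class `𝔄_m({□_j}, α₀)` (`B8Ineq132.InAk`), whose level-`0` clause controls EXACTLY the plaquettes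
TOUCHING `□₀` — some based outside `□₀` —, and the frame's class (3.35) (`bgZd.Reg335`, cubes inside `Ω₀`) controls even less (LOCATED-SELF-6 of this seat:
the collar is invisible to it).  THIS FILE supplies the sharp locality that the layer-gauge schema of `B8LayerAxialGauge` (dag-n05-w3 g3) needs as its (L)
input: two backgrounds agreeing on the SIDES OF THE PLAQUETTES TOUCHING `Ω₀` (`B8Eq140Level.SideTouches`) give the same `Δ_a(U₀)A` at every bond touching
`Ω₀`, for every field `A`, letter by letter — `D*D` (`B8Ineq159CurvedCubeMemberReads.Jcur_congr_touch`, dag-n05-w3), `Δ′(U₀)` (§1: the plaquettes THROUGH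
the bond and the base conjugations `(x − e_ν, ν)`, `ν ≠ μ` — the `ν = μ` conjugation of the letter divergence `divL` is multiplied by `0` and never read),
`D R(U₀) 𝟙 D*` (§2: `B8Ineq159CurvedCubeMemberReads.covLap_congr_bg_bonds` for the generators of `R`, the block towers under the `Λ_j`-sites), `Q*aQ(U₀)`
(§3: the four sides of each guard plaquette of (1.7), the boxes of the class bonds) — hence (§4) the regularity predicates and the pairing transfer, and (§5)
at a cube member (`Ω = cubeFam false …`, `Λs = cubeLamS …`, class `cubeLamBP`, `m ≤ k`, `2 ≤ d`, `2 ≤ L ≤ ρ`) agreement on `SideTouches (i.Ω 0)` ALONE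
suffices (the block towers and the class boxes lie inside `□₀`, whose bonds are sides of touching plaquettes).

WHAT IS PROVED (kernel, 0 sorry, 0 def; no `instance`, no `notation`).
* §1 `divL_congr_bg_ne` (the letter divergence reads the base conjugations `(ν, x − e_ν)` for `ν ≠ μ` only), `deltaPrimeOp_congr_bg_ne`,
  ★ `DpZd_congr_bondNear` (`(Δ′(U₀)A)(⟨x, x+e_μ⟩)` reads `U₀` on `B8Eq140Level.BondNear μ x` = the sides of the plaquettes through the bond),
  `DpZd_congr_touch`.
* §2 `rangeGen_congr_bonds` ∕ `rangeSub_congr_bonds` ∕ `projE_congr_bonds` ∕ `projR_congr_bonds` (the generators `𝟙_{Ω₀}Δ^η_{U₀}λ` read the bonds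
  `(x, ν)`, `(x − e_ν, ν)` of the `Ω₀`-sites and the block towers), ★ `opsLandau_DRDs_congr_bonds`.
* §3 `plaqF_congr_sides`, ★ `reg17_congr_sides`, ★ `QQZdP_congr_sides`.
* §4 ★★ `deltaAOf_opsAllZd_congr_sides` (`2 ≤ d`, finite `Ω₀`, `L ≥ 1`: agreement on `SideTouches (i.Ω 0)` + on the block towers under the `Λ_j`-sites +
  on the boxes of the class bonds of level `≥ 1`), ★★★ `regular_opsAllZd_congr_sides` (the four transfers).
* §5 ★★★ `regular_opsAllZd_congr_cube_sides` — THE (L) INPUT IN THE TOUCHING CURRENCY at a cube member.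

HONEST SCOPE.  Lattice bookkeeping (which bonds each landed letter reads), sharpening g19's unit-ball read sets to print's p. 77 convention; no estimate;
nothing of [B9] Thm 3.3 ∕ 3.11's uniformity; count-neutral helper of K1⁷ (`--supports stmt-QuantumFields-20542`); N05∕N06 NOT discharged; one finite `𝕋⁴`
programme at fixed `ε`, Bałaban as printed; R4 closes only the conditional finite-`𝕋⁴` rung `BalabanLadder.UV` — nothing continuum ∕ `ℝ⁴` ∕ OS ∕ mass
gap ∕ Clay.  Unit `pub-ymgap-dag-n06-b` (g20), 2026-08-28.
-/

noncomputable section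

open scoped BigOperators
open NormedSpace Complex

namespace Literature.MathematicalPhysics.QuantumFieldTheory.Balaban1983to89.B9Eq326DeltaALocalityZdSides

export B7Prop1Explicit (Site)

/-! ## §1 The curvature letter `Δ′(U₀)` reads the sides of the plaquettes through the bond -/

section DeltaPrime

open Literature.MathematicalPhysics.QuantumFieldTheory.Balaban1983to89.B9Eq37Insertion
open Literature.MathematicalPhysics.QuantumFieldTheory.Balaban1983to89.B9Eq39Adjoint
open Literature.MathematicalPhysics.QuantumFieldTheory.Balaban1983to89.B9Eq310Hermitian
open B9Eq369Small (Through)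
open B9Eq326DeltaALocalityZd (letters_congr_bg)

variable {𝔸 : Type*} [Ring 𝔸] [Algebra ℂ 𝔸] {S : Type*} {ι : Type*} (T : ι → Equiv.Perm S) {U U' : ι → S → 𝔸ˣ}
variable [Fintype ι] [LinearOrder ι]

omit [Algebra ℂ 𝔸] in
/-- the letter divergence `÷` at the bond `⟨x, x+e_μ⟩` reads the background's conjugations at the bonds `(ν, x − e_ν)` for `ν ≠ μ` ONLY (the `ν = μ` summands
of both sums vanish by the order guards `ν < μ`, `μ < ν`). [cite: Balaban1985BackgroundPropagators, (3.9) p.392, (3.10) p.392] -/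
theorem divL_congr_bg_ne (G₁ G₂ G₃ G₄ : ι → ι → S → 𝔸) (μ : ι) (x : S)
    (h : ∀ ν, ν ≠ μ → U ν ((T ν).symm x) = U' ν ((T ν).symm x)) :
    divL T U G₁ G₂ G₃ G₄ μ x = divL T U' G₁ G₂ G₃ G₄ μ x := by
  unfold divL
  congr 1
  · refine Finset.sum_congr rfl fun ν _ => ?_
    split_ifs with hν
    · rw [h ν (ne_of_lt hν)]
    · rfl
  · refine Finset.sum_congr rfl fun ν _ => ?_
    split_ifs with hν
    · rw [h ν (ne_of_gt hν)]
    · rfl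

/-- ★ **`Δ′` READS THE BACKGROUND ON THE PLAQUETTES THROUGH THE BOND AND AT THE BASE CONJUGATIONS `(ν, x − e_ν)`, `ν ≠ μ`** — the sharp form of
`B9Eq326DeltaALocalityZd.deltaPrimeOp_congr_bg`. [cite: Balaban1985BackgroundPropagators, (3.10) p.392, (3.69) p.404 («bonds belonging to one of the plaquettes containing the bond b»)] -/
theorem deltaPrimeOp_congr_bg_ne (η : ℝ) (A : ι → S → 𝔸) (μ : ι) (x : S)
    (hx : ∀ ν, ν ≠ μ → U ν ((T ν).symm x) = U' ν ((T ν).symm x))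
    (hpl : ∀ κ ν y, Through T μ x κ ν y →
      U κ y = U' κ y ∧ U ν (T κ y) = U' ν (T κ y) ∧ U κ (T ν y) = U' κ (T ν y) ∧ U ν y = U' ν y) :
    deltaPrimeOp T U η A μ x = deltaPrimeOp T U' η A μ x := by
  have hJ : ∀ κ ν y, Through T μ x κ ν y → jordanF T U η A κ ν y = jordanF T U' η A κ ν y ∧
      jordanF T U η A κ ν y = jordanF T U' η A κ ν y ∧ jordanF T U η A κ ν y = jordanF T U' η A κ ν y ∧
      jordanF T U η A κ ν y = jordanF T U' η A κ ν y := by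
    intro κ ν y h
    obtain ⟨h1, h2, h3, h4⟩ := hpl κ ν y h
    have e := (letters_congr_bg T η A h1 h2 h3 h4).1
    exact ⟨e, e, e, e⟩
  have hG : ∀ κ ν y, Through T μ x κ ν y → commG₁ T U η A κ ν y = commG₁ T U' η A κ ν y ∧
      commG₂ T U η A κ ν y = commG₂ T U' η A κ ν y ∧ commG₃ T U η A κ ν y = commG₃ T U' η A κ ν y ∧
      commG₄ T U η A κ ν y = commG₄ T U' η A κ ν y := by
    intro κ ν y h
    obtain ⟨h1, h2, h3, h4⟩ := hpl κ ν y h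
    exact (letters_congr_bg T η A h1 h2 h3 h4).2
  unfold deltaPrimeOp
  rw [← divL_self, ← divL_self, B9Eq369Small.divL_congr_local T U μ x hJ, B9Eq369Small.divL_congr_local T U μ x hG,
    divL_congr_bg_ne T _ _ _ _ μ x hx, divL_congr_bg_ne T _ _ _ _ μ x hx]

end DeltaPrime

section DpZd

open B7Prop1Explicit (e)
open B8Eq133Hypotheses (shiftT byDir shiftT_apply byDir_apply)
open B8Ineq132 (BondTouches)
open B8Eq140Level (SideTouches BondNear IsSide bondNear_of plaqNear₁ plaqNear₂ plaqNear₃ plaqNear₄ isSide₁ isSide₂ isSide₃ isSide₄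
  sideTouches_of_bondNear)
open B9Eq369CurvSmallZd (DpZd shiftT_symm_apply)
open B9Eq369Small (Through)

variable {d : ℕ} {𝔸 : Type*} [CStarAlgebra 𝔸]

/-- ★ **THE GENUINE `Δ′(U₀)` ON `ℤᵈ` READS THE BACKGROUND ON THE SIDES OF THE PLAQUETTES THROUGH THE BOND** (`B8Eq140Level.BondNear μ x`): if `U₀(y, τ) =
U₀′(y, τ)` on those sides, then `(Δ′(U₀)A)(⟨x, x+e_μ⟩) = (Δ′(U₀′)A)(⟨x, x+e_μ⟩)`.  The base conjugation bond `⟨x − e_ν, x⟩` (`ν ≠ μ`) is the first side of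
`p_{νμ}(x − e_ν)`, a plaquette through the bond. [cite: Balaban1985BackgroundPropagators, (3.10) p.392, (3.69) p.404; Balaban1985RegularSpaces, (1.2) p.76] -/
theorem DpZd_congr_bondNear (η : ℝ) {U₀ U₀' : Site d → Fin d → 𝔸ˣ} (A : Site d → Fin d → 𝔸) (x : Site d) (μ : Fin d)
    (h : ∀ (y : Site d) (τ : Fin d), BondNear μ x y τ → U₀ y τ = U₀' y τ) :
    DpZd η U₀ A x μ = DpZd η U₀' A x μ := by
  have four : ∀ (z : Site d) (κ ν : Fin d), B8Eq140Level.PlaqNear μ x z κ ν →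
      U₀ z κ = U₀' z κ ∧ U₀ (z + e κ) ν = U₀' (z + e κ) ν ∧ U₀ (z + e ν) κ = U₀' (z + e ν) κ ∧ U₀ z ν = U₀' z ν :=
    fun z κ ν hq => ⟨h _ _ (bondNear_of hq (isSide₁ z κ ν)), h _ _ (bondNear_of hq (isSide₂ z κ ν)),
      h _ _ (bondNear_of hq (isSide₃ z κ ν)), h _ _ (bondNear_of hq (isSide₄ z κ ν))⟩
  unfold DpZd
  refine deltaPrimeOp_congr_bg_ne (shiftT d) η (byDir A) μ x (fun ν hν => ?_) (fun κ ν y hy => ?_)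
  · rw [shiftT_symm_apply]
    simp only [byDir_apply]
    exact h _ _ (bondNear_of (plaqNear₃ hν) (isSide₁ _ ν μ))
  · obtain ⟨hκν, ⟨hνμ, hy⟩ | ⟨hκμ, hy⟩⟩ := hy
    · -- the plaquettes `p_{κμ}(x)`, `p_{κμ}(x − e_κ)` (`κ < ν = μ`)
      rw [hνμ] at hκν ⊢
      simp only [byDir_apply, shiftT_apply]
      rcases hy with hy | hy <;> rw [hy]
      · exact four x κ μ (plaqNear₁ (ne_of_lt hκν))
      · rw [shiftT_symm_apply]
        exact four (x - e κ) κ μ (plaqNear₃ (ne_of_lt hκν))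
    · -- the plaquettes `p_{μν}(x)`, `p_{μν}(x − e_ν)` (`μ = κ < ν`)
      rw [hκμ] at hκν ⊢
      simp only [byDir_apply, shiftT_apply]
      rcases hy with hy | hy <;> rw [hy]
      · exact four x μ ν (plaqNear₂ (ne_of_gt hκν))
      · rw [shiftT_symm_apply]
        exact four (x - e ν) μ ν (plaqNear₄ (ne_of_gt hκν))

/-- `Δ′(U₀)A` at a bond touching `S` reads the background on `SideTouches S`. [cite: Balaban1985BackgroundPropagators, (3.10) p.392; Balaban1985RegularSpaces, p.77 (touching convention)] -/
theorem DpZd_congr_touch (η : ℝ) {U₀ U₀' : Site d → Fin d → 𝔸ˣ} {S : Set (Site d)} (A : Site d → Fin d → 𝔸) {x : Site d} {μ : Fin d}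
    (hb : BondTouches S x μ) (h : ∀ (y : Site d) (τ : Fin d), SideTouches S y τ → U₀ y τ = U₀' y τ) :
    DpZd η U₀ A x μ = DpZd η U₀' A x μ :=
  DpZd_congr_bondNear η A x μ fun y τ hn => h y τ (sideTouches_of_bondNear hb hn)

end DpZd

/-! ## §2 The gauge-fixing letter `D R(U₀) 𝟙_{Ω₀} D*`: the generators read the bonds at and below the `Ω₀`-sites, the null space the block towers -/

section Landau

open Literature.MathematicalPhysics.QuantumLattice (blockBase)
open B7Prop1Explicit (e)
open B7Prop1Local (AgreeOn)
open B8Eq138LandauZd (covLap covDivB)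
open B8Ineq132 (covDerivFwd)
open B8Ineq159CurvedCubeMemberLocal (covDivB_congr_bg covDerivFwd_congr_bg)
open B8Ineq159CurvedCubeMemberReads (covLap_congr_bg_bonds)
open B8LeafModelZd (ZdIdx)
open B9SupplySockB9P3ZdLetters (OpsZd)
open B9Eq321LandauProjectionZd (gaugeNull rangeGen rangeSub projE projR opsLandau opsLandau_DRDs_of_finite)
open B9Eq326DeltaALocalityZd (gaugeNull_congr_bg projR_congr_fun)

variable {d : ℕ} {𝔸 : Type*} [CStarAlgebra 𝔸] {U₀ U₀' : Site d → Fin d → 𝔸ˣ}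
variable (s : Finset (Site d)) (L m : ℕ) (η : ℝ) (Λs : ℕ → Set (Site d))

/-- **THE GENERATORS `𝟙_{Ω₀}Δ^η_{U₀}λ` READ THE BONDS `(x, ν)`, `(x − e_ν, ν)` OF THE `Ω₀`-SITES `x`** (and `N_𝔤(Q′(U₀))` the block towers).
[cite: Balaban1985BackgroundPropagators, (3.21) p.394, (3.23) p.394] -/
theorem rangeGen_congr_bonds (hL : 1 ≤ L)
    (hΛ : ∀ j, j ≤ m → ∀ y ∈ Λs j, AgreeOn (blockBase (L ^ j) y) (blockBase (L ^ j) y + (((L : ℤ) ^ j) - 1) • (1 : Site d)) U₀ U₀')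
    (hs : ∀ x ∈ s, ∀ ν : Fin d, U₀ x ν = U₀' x ν ∧ U₀ (x - e ν) ν = U₀' (x - e ν) ν) :
    rangeGen s L m η Λs U₀ = rangeGen s L m η Λs U₀' := by
  have hind : ∀ lam : Site d → 𝔸, (↑s : Set (Site d)).indicator (covLap η U₀ lam) = (↑s : Set (Site d)).indicator (covLap η U₀' lam) := by
    intro lam
    funext x
    by_cases hx : x ∈ (↑s : Set (Site d))
    · rw [Set.indicator_of_mem hx, Set.indicator_of_mem hx]
      exact covLap_congr_bg_bonds lam x (fun ν => (hs x (Finset.mem_coe.mp hx) ν).1) (fun ν => (hs x (Finset.mem_coe.mp hx) ν).2)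
    · rw [Set.indicator_of_notMem hx, Set.indicator_of_notMem hx]
  ext w
  simp only [rangeGen, Set.mem_setOf_eq, gaugeNull_congr_bg s L m Λs hL hΛ, hind]

/-- `R = Δ^η_{U₀}N_𝔤(Q′(U₀))` as a subspace reads the same bonds. [cite: Balaban1985BackgroundPropagators, (3.21) p.394] -/
theorem rangeSub_congr_bonds (hL : 1 ≤ L)
    (hΛ : ∀ j, j ≤ m → ∀ y ∈ Λs j, AgreeOn (blockBase (L ^ j) y) (blockBase (L ^ j) y + (((L : ℤ) ^ j) - 1) • (1 : Site d)) U₀ U₀')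
    (hs : ∀ x ∈ s, ∀ ν : Fin d, U₀ x ν = U₀' x ν ∧ U₀ (x - e ν) ν = U₀' (x - e ν) ν) :
    rangeSub s L m η Λs U₀ = rangeSub s L m η Λs U₀' := by
  unfold rangeSub
  rw [rangeGen_congr_bonds s L m η Λs hL hΛ hs]

variable (τ : 𝔸 →ₗ[ℂ] ℂ)

/-- ★ **THE PROJECTION `R(U₀)` OF (3.21)–(3.22) READS THE BONDS AT AND BELOW THE `Ω₀`-SITES AND THE BLOCK TOWERS UNDER THE `Λ_j`-SITES.**
[cite: Balaban1985BackgroundPropagators, (3.21)–(3.22) p.394] -/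
theorem projE_congr_bonds (hL : 1 ≤ L)
    (hΛ : ∀ j, j ≤ m → ∀ y ∈ Λs j, AgreeOn (blockBase (L ^ j) y) (blockBase (L ^ j) y + (((L : ℤ) ^ j) - 1) • (1 : Site d)) U₀ U₀')
    (hs : ∀ x ∈ s, ∀ ν : Fin d, U₀ x ν = U₀' x ν ∧ U₀ (x - e ν) ν = U₀' (x - e ν) ν) :
    projE τ s L m η Λs U₀ = projE τ s L m η Λs U₀' := by
  unfold projE
  rw [rangeSub_congr_bonds s L m η Λs hL hΛ hs]

/-- `R(U₀)` on functions reads the same bonds. [cite: Balaban1985BackgroundPropagators, (3.21)–(3.22) p.394, (3.24) p.394] -/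
theorem projR_congr_bonds (hL : 1 ≤ L)
    (hΛ : ∀ j, j ≤ m → ∀ y ∈ Λs j, AgreeOn (blockBase (L ^ j) y) (blockBase (L ^ j) y + (((L : ℤ) ^ j) - 1) • (1 : Site d)) U₀ U₀')
    (hs : ∀ x ∈ s, ∀ ν : Fin d, U₀ x ν = U₀' x ν ∧ U₀ (x - e ν) ν = U₀' (x - e ν) ν) (f : Site d → 𝔸) :
    projR τ s L m η Λs U₀ f = projR τ s L m η Λs U₀' f := by
  unfold projR
  rw [projE_congr_bonds s L m η Λs τ hL hΛ hs]

/-- ★★ **THE GENUINE LETTER `D R(U₀) 𝟙_{Ω₀} D*` AT A MEMBER WITH FINITE `Ω₀` READS THE BACKGROUND ON: the bond itself, the bonds `(x′, ν)` and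
`(x′ − e_ν, ν)` at the `Ω₀`-sites `x′` (the divergence `D*` and the Laplacian in the generators of `R`) and the block towers under the `Λ_j`-sites** —
all of them bonds TOUCHING `Ω₀` or inside the towers. [cite: Balaban1985BackgroundPropagators, (3.20)–(3.26) pp.394–395] -/
theorem opsLandau_DRDs_congr_bonds {L : ℕ} (hL : 1 ≤ L) (ops₀ : ℝ → ZdIdx d L → ℕ → OpsZd d 𝔸) (M : ℝ) (i : ZdIdx d L) (m : ℕ)
    (hΩ : (i.Ω 0).Finite) (A : Site d → Fin d → 𝔸) (x : Site d) (μ : Fin d) (hxμ : U₀ x μ = U₀' x μ)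
    (hΛ : ∀ j, j ≤ m → ∀ y ∈ i.Λs m j, AgreeOn (blockBase (L ^ j) y) (blockBase (L ^ j) y + (((L : ℤ) ^ j) - 1) • (1 : Site d)) U₀ U₀')
    (hs : ∀ x' ∈ i.Ω 0, ∀ ν : Fin d, U₀ x' ν = U₀' x' ν ∧ U₀ (x' - e ν) ν = U₀' (x' - e ν) ν) :
    (opsLandau τ ops₀ M i m).DRDs U₀ A x μ = (opsLandau τ ops₀ M i m).DRDs U₀' A x μ := by
  rw [opsLandau_DRDs_of_finite τ ops₀ M i m hΩ, opsLandau_DRDs_of_finite τ ops₀ M i m hΩ]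
  have hs' : ∀ x' ∈ hΩ.toFinset, ∀ ν : Fin d, U₀ x' ν = U₀' x' ν ∧ U₀ (x' - e ν) ν = U₀' (x' - e ν) ν :=
    fun x' hx' => hs x' (hΩ.mem_toFinset.mp hx')
  have hdiv : ∀ x' ∈ hΩ.toFinset, covDivB i.η U₀ A x' = covDivB i.η U₀' A x' :=
    fun x' hx' => covDivB_congr_bg A x' fun ν => (hs' x' hx' ν).2
  rw [covDerivFwd_congr_bg μ _ x hxμ, projR_congr_fun hΩ.toFinset L m i.η (i.Λs m) τ hdiv,
    projR_congr_bonds hΩ.toFinset L m i.η (i.Λs m) τ hL hΛ hs']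

end Landau

/-! ## §3 The averaging letter `Q*aQ` (`QQZdP`): the (1.7) guard reads the four sides of each plaquette touching `Ω_j` -/

section Averaging

open B7Prop1Explicit (e)
open B7Prop1Local (InBox AgreeOn loK bondHiK)
open B8Ineq132 (plaqF PlaqTouches BondTouches)
open B8Eq133Hypotheses (shiftT byDir byDir_apply shiftT_apply)
open B8Eq140Level (IsSide isSide₁ isSide₂ isSide₃ isSide₄)
open B8LeafModelZd (ZdIdx)
open B9Eq369CurvSmallZd (val_plaqU_shiftT_byDir)
open B9Eq316AveragingTransposeZd (Reg17 alphaQ)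
open B9Eq316AveragingTransposeZdPrinted (QQZdP QQZdP_of_reg17 QQZdP_of_not_reg17)
open B9Eq326DeltaALocalityZd (plaqU_congr_bg linCovIterT_clsField_congr_bg)

variable {d : ℕ} {𝔸 : Type*} [CStarAlgebra 𝔸] {U₀ U₀' : Site d → Fin d → 𝔸ˣ}

/-- the plaquette field `U(∂p_{μν}(x))` reads the background on the four sides of `p_{μν}(x)`. [cite: Balaban1985RegularSpaces, (1.2) p.76] -/
theorem plaqF_congr_sides (μ ν : Fin d) (x : Site d) (h1 : U₀ x μ = U₀' x μ) (h2 : U₀ (x + e μ) ν = U₀' (x + e μ) ν)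
    (h3 : U₀ (x + e ν) μ = U₀' (x + e ν) μ) (h4 : U₀ x ν = U₀' x ν) : plaqF U₀ μ ν x = plaqF U₀' μ ν x := by
  rw [← val_plaqU_shiftT_byDir, ← val_plaqU_shiftT_byDir]
  congr 1
  refine plaqU_congr_bg (shiftT d) ?_ ?_ ?_ ?_ <;> simp only [byDir_apply, shiftT_apply]
  exacts [h1, h2, h3, h4]

/-- ★ **THE CLASS (1.7) GUARD READS THE FOUR SIDES OF EACH PLAQUETTE TOUCHING THE `Ω_j`**: `Reg17 L m Ω α U₀ ↔ Reg17 L m Ω α U₀′` when the backgrounds agree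
on `IsSide x μ ν` for every plaquette `p_{μν}(x)` touching some `Ω_j`, `j ≤ m`. [cite: Balaban1985RegularSpaces, (1.7) p.77, (1.2) p.76] -/
theorem reg17_congr_sides {L m : ℕ} {Ω : ℕ → Set (Site d)} {α : ℝ}
    (h : ∀ j, j ≤ m → ∀ (x : Site d) (μ ν : Fin d), μ ≠ ν → PlaqTouches (Ω j) x μ ν →
      ∀ (y : Site d) (τ : Fin d), IsSide x μ ν y τ → U₀ y τ = U₀' y τ) :
    Reg17 L m Ω α U₀ ↔ Reg17 L m Ω α U₀' := by
  have hp : ∀ j, j ≤ m → ∀ (x : Site d) (μ ν : Fin d), μ ≠ ν → PlaqTouches (Ω j) x μ ν → plaqF U₀ μ ν x = plaqF U₀' μ ν x :=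
    fun j hj x μ ν hμν hpt => plaqF_congr_sides μ ν x (h j hj x μ ν hμν hpt _ _ (isSide₁ x μ ν))
      (h j hj x μ ν hμν hpt _ _ (isSide₂ x μ ν)) (h j hj x μ ν hμν hpt _ _ (isSide₃ x μ ν)) (h j hj x μ ν hμν hpt _ _ (isSide₄ x μ ν))
  refine ⟨fun hr j hj x μ ν hμν hpt => ?_, fun hr j hj x μ ν hμν hpt => ?_⟩
  · rw [← hp j hj x μ ν hμν hpt]; exact hr j hj x μ ν hμν hpt
  · rw [hp j hj x μ ν hμν hpt]; exact hr j hj x μ ν hμν hpt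

variable {L : ℕ}

/-- ★ **THE GENUINE `Q*aQ` LETTER READS THE BACKGROUND ON THE SIDES OF THE PLAQUETTES TOUCHING THE `Ω_j` (its (1.7) guard) AND ON THE BOXES OF THE CLASS
BONDS OF LEVEL `≥ 1`.** [cite: Balaban1985BackgroundPropagators, (3.16) p.393; Balaban1985RegularSpaces, (1.7) p.77, (1.31) p.82; Balaban1985Averaging, p.24] -/
theorem QQZdP_congr_sides [FiniteDimensional ℝ 𝔸] (τ : 𝔸 →ₗ[ℂ] ℂ) (hL : 1 ≤ L) (ΛbP : ℕ → ℕ → Set (Site d × Fin d)) (i : ZdIdx d L) (m : ℕ)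
    (A : Site d → Fin d → 𝔸) (y : Site d) (μ : Fin d)
    (h17 : ∀ j, j ≤ m → ∀ (x : Site d) (μ' ν : Fin d), μ' ≠ ν → PlaqTouches (i.Ω j) x μ' ν →
      ∀ (z : Site d) (κ : Fin d), IsSide x μ' ν z κ → U₀ z κ = U₀' z κ)
    (hcls : ∀ j, 1 ≤ j → j ≤ m → ∀ c ∈ ΛbP m j, AgreeOn (loK L j c.1) (bondHiK L j c.1 c.2) U₀ U₀') :
    QQZdP τ L ΛbP i m U₀ A y μ = QQZdP τ L ΛbP i m U₀' A y μ := by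
  have hiff := reg17_congr_sides (L := L) (m := m) (Ω := i.Ω) (α := alphaQ d L / (L : ℝ) ^ 2) h17
  by_cases hreg : Reg17 L m i.Ω (alphaQ d L / (L : ℝ) ^ 2) U₀
  · rw [QQZdP_of_reg17 τ L hreg, QQZdP_of_reg17 τ L (hiff.mp hreg)]
    refine Finset.sum_congr rfl fun j hjm => ?_
    have hj : j ≤ m := by rw [Finset.mem_range] at hjm; omega
    rw [linCovIterT_clsField_congr_bg τ hL ΛbP i.η m j A (fun hj1 => hcls j hj1 hj) y μ]
  · rw [QQZdP_of_not_reg17 τ L hreg, QQZdP_of_not_reg17 τ L (fun h => hreg (hiff.mpr h))]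

end Averaging

/-! ## §4 `Δ_a(U₀)` of the four-letter record on the bonds touching `Ω₀` reads the sides of the plaquettes touching `Ω₀` -/

section Record

open Literature.MathematicalPhysics.QuantumLattice (blockBase)
open B7Prop1Explicit (e)
open B7Prop1Local (InBox AgreeOn loK bondHiK)
open B8Ineq132 (PlaqTouches BondTouches)
open B8Eq140Level (SideTouches IsSide sideTouches_of_bondTouches sideTouches_of_plaqTouches sideTouches_mono)
open B8Eq155JBound (Jcur)
open B8Ineq159CurvedCubeMemberReads (Jcur_congr_touch)
open B8LeafModelZd (ZdIdx)
open B9Eq369CurvSmallZd (DpZd)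
open B9SupplySockB9P3ZdGammaInAkDpZd (withDpZd)
open B9SupplySockB9P3ZdLetters (OpsZd deltaAOf)
open B9SupplySockB9P3ZdLettersOmega (omega_subset_of_le)
open B9Eq327GreenZd (domSub bondPair RegularAt)
open B9Eq327GreenZdHerm (RegularAtH HermPreservingAt)
open B9Eq321LandauProjectionZd (opsLandau)
open B9Eq316AveragingTransposeZdPrinted (QQZdP withQQP)
open B9SupplySockB9P3ZdAllLettersZd (opsAllZd)
open B9Eq326DeltaALocalityZd (regular_opsAllZd_congr_of_key)

variable {d : ℕ} {𝔸 : Type*} [CStarAlgebra 𝔸]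

omit [CStarAlgebra 𝔸] in
/-- in dimension `d ≥ 2` every direction has a second one. [folklore] -/
private theorem exists_ne_dir (hd2 : 2 ≤ d) (μ : Fin d) : ∃ κ : Fin d, κ ≠ μ := by
  by_cases h : (μ : ℕ) = 0
  · exact ⟨⟨1, by omega⟩, fun e => by have := congrArg Fin.val e; simp [h] at this⟩
  · exact ⟨⟨0, by omega⟩, fun e => by have := congrArg Fin.val e; simp at this; omega⟩

variable (τ : 𝔸 →ₗ[ℂ] ℂ) [FiniteDimensional ℝ 𝔸] {L : ℕ}

/-- ★★ **`Δ_a(U₀)` OF THE FOUR-LETTER RECORD AT A BOND TOUCHING `Ω₀` READS THE BACKGROUND ON THE SIDES OF THE PLAQUETTES TOUCHING `Ω₀`** (`d ≥ 2`, finite `Ω₀`,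
`L ≥ 1`) — plus, displayed, the block towers under the `Λ_j`-sites (`D R(U₀) 𝟙 D*`) and the boxes of the class bonds of level `≥ 1` (`Q*aQ`), which at a
lawful member lie inside `Ω₀`.  Letters: `D*D` (`Jcur_congr_touch`), `Δ′` (`DpZd_congr_touch`), `D R 𝟙 D*` (`opsLandau_DRDs_congr_bonds`: the bonds
`(x′, ν)`, `(x′ − e_ν, ν)` touch `Ω₀`), `Q*aQ` (`QQZdP_congr_sides`: the guard plaquettes touch `Ω_j ⊆ Ω₀`).
[cite: Balaban1985BackgroundPropagators, (3.26) p.395, (3.10) p.392, (3.16) p.393, (3.20)–(3.25) p.394; Balaban1985RegularSpaces, p.77 (touching convention)] -/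
theorem deltaAOf_opsAllZd_congr_sides (hd2 : 2 ≤ d) (hL : 1 ≤ L) (ΛbP : ℕ → ℕ → Set (Site d × Fin d))
    (ops₀ : ℝ → ZdIdx d L → ℕ → OpsZd d 𝔸) (M : ℝ) (i : ZdIdx d L) (m : ℕ) (hΩ : (i.Ω 0).Finite) {U₀ U₀' : Site d → Fin d → 𝔸ˣ}
    (A : Site d → Fin d → 𝔸) {x : Site d} {μ : Fin d} (hb : BondTouches (i.Ω 0) x μ)
    (hside : ∀ (y : Site d) (τ' : Fin d), SideTouches (i.Ω 0) y τ' → U₀ y τ' = U₀' y τ')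
    (hΛ : ∀ j, j ≤ m → ∀ y ∈ i.Λs m j, AgreeOn (blockBase (L ^ j) y) (blockBase (L ^ j) y + (((L : ℤ) ^ j) - 1) • (1 : Site d)) U₀ U₀')
    (hcls : ∀ j, 1 ≤ j → j ≤ m → ∀ c ∈ ΛbP m j, AgreeOn (loK L j c.1) (bondHiK L j c.1 c.2) U₀ U₀') :
    deltaAOf i.η (opsAllZd τ L ΛbP ops₀ M i m) U₀ A x μ = deltaAOf i.η (opsAllZd τ L ΛbP ops₀ M i m) U₀' A x μ := by
  -- bonds touching `Ω₀` are sides of touching plaquettes (`d ≥ 2`)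
  have htouch : ∀ (y : Site d) (τ' : Fin d), BondTouches (i.Ω 0) y τ' → U₀ y τ' = U₀' y τ' := fun y τ' hy => by
    obtain ⟨κ, hκ⟩ := exists_ne_dir hd2 τ'
    exact hside y τ' (sideTouches_of_bondTouches hκ hy)
  have hxμ : U₀ x μ = U₀' x μ := htouch x μ hb
  have hs : ∀ x' ∈ i.Ω 0, ∀ ν : Fin d, U₀ x' ν = U₀' x' ν ∧ U₀ (x' - e ν) ν = U₀' (x' - e ν) ν := fun x' hx' ν =>
    ⟨htouch x' ν (Or.inl hx'), htouch (x' - e ν) ν (Or.inr (by rw [sub_add_cancel]; exact hx'))⟩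
  have h17 : ∀ j, j ≤ m → ∀ (x' : Site d) (μ' ν : Fin d), μ' ≠ ν → PlaqTouches (i.Ω j) x' μ' ν →
      ∀ (z : Site d) (κ : Fin d), IsSide x' μ' ν z κ → U₀ z κ = U₀' z κ := fun j _ x' μ' ν hμν hpt z κ hzs =>
    hside z κ (sideTouches_mono (omega_subset_of_le i (Nat.zero_le j)) (sideTouches_of_plaqTouches hμν hpt hzs))
  show Jcur i.η U₀ A μ x + DpZd i.η U₀ A x μ + (opsLandau τ (withDpZd (withQQP τ L ΛbP ops₀)) M i m).DRDs U₀ A x μ + QQZdP τ L ΛbP i m U₀ A x μ =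
    Jcur i.η U₀' A μ x + DpZd i.η U₀' A x μ + (opsLandau τ (withDpZd (withQQP τ L ΛbP ops₀)) M i m).DRDs U₀' A x μ + QQZdP τ L ΛbP i m U₀' A x μ
  rw [Jcur_congr_touch A hb hside, DpZd_congr_touch i.η A hb hside, opsLandau_DRDs_congr_bonds τ hL _ M i m hΩ A x μ hxμ hΛ hs,
    QQZdP_congr_sides τ hL ΛbP i m A x μ h17 hcls]

/-- ★★★ **`RegularAtH` ∕ `RegularAt` ∕ `HermPreservingAt` ∕ THE FORM `⟨A, Δ_aA⟩_τ` OF THE FOUR-LETTER RECORD READ THE BACKGROUND ON THE SIDES OF THE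
PLAQUETTES TOUCHING `Ω₀`** (`d ≥ 2`, finite `Ω₀`, `L ≥ 1`; block towers and class boxes displayed). [cite: Balaban1985BackgroundPropagators, (3.27) p.395, Thm 3.11 p.416; Balaban1985RegularSpaces, p.77] -/
theorem regular_opsAllZd_congr_sides (hd2 : 2 ≤ d) (hL : 1 ≤ L) (ΛbP : ℕ → ℕ → Set (Site d × Fin d))
    (ops₀ : ℝ → ZdIdx d L → ℕ → OpsZd d 𝔸) (M : ℝ) (i : ZdIdx d L) (m : ℕ) (hΩ : (i.Ω 0).Finite) {U₀ U₀' : Site d → Fin d → 𝔸ˣ}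
    (hside : ∀ (y : Site d) (τ' : Fin d), SideTouches (i.Ω 0) y τ' → U₀ y τ' = U₀' y τ')
    (hΛ : ∀ j, j ≤ m → ∀ y ∈ i.Λs m j, AgreeOn (blockBase (L ^ j) y) (blockBase (L ^ j) y + (((L : ℤ) ^ j) - 1) • (1 : Site d)) U₀ U₀')
    (hcls : ∀ j, 1 ≤ j → j ≤ m → ∀ c ∈ ΛbP m j, AgreeOn (loK L j c.1) (bondHiK L j c.1 c.2) U₀ U₀') :
    (RegularAtH i.η (opsAllZd τ L ΛbP ops₀ M i m) (i.Ω 0) U₀ ↔ RegularAtH i.η (opsAllZd τ L ΛbP ops₀ M i m) (i.Ω 0) U₀') ∧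
      (RegularAt i.η (opsAllZd τ L ΛbP ops₀ M i m) (i.Ω 0) U₀ ↔ RegularAt i.η (opsAllZd τ L ΛbP ops₀ M i m) (i.Ω 0) U₀') ∧
      (HermPreservingAt i.η (opsAllZd τ L ΛbP ops₀ M i m) (i.Ω 0) U₀ ↔ HermPreservingAt i.η (opsAllZd τ L ΛbP ops₀ M i m) (i.Ω 0) U₀') ∧
      (∀ A ∈ domSub (𝔸 := 𝔸) (i.Ω 0), bondPair τ A (deltaAOf i.η (opsAllZd τ L ΛbP ops₀ M i m) U₀ A) =
        bondPair τ A (deltaAOf i.η (opsAllZd τ L ΛbP ops₀ M i m) U₀' A)) :=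
  regular_opsAllZd_congr_of_key τ ΛbP ops₀ M i m fun A _ _ hyμ =>
    deltaAOf_opsAllZd_congr_sides τ hd2 hL ΛbP ops₀ M i m hΩ A hyμ hside hΛ hcls

end Record

/-! ## §5 The cube member: agreement on the sides of the plaquettes touching `□₀` suffices -/

section Cube

open Literature.MathematicalPhysics.QuantumLattice (blockBase)
open B7Prop1Explicit (e)
open B7Prop1Local (InBox AgreeOn loK bondHiK)
open B8Ineq132 (Under PlaqTouches BondTouches)
open B8Eq140Level (SideTouches sideTouches_of_bondTouches)
open B8Eq131Cubes (cube sqLo sqHi cube_anti mem_cube_iff)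
open B8Eq131CubesAdmissible (cubeFam cubeFam_false_of_le cubeFam_false_zero)
open B8CubeMemberZd (cubeLamS inBox_sq_of_mem_cubeLamS)
open B8Ineq159FlatCubeMemberPrinted (cubeLamBP)
open B8LeafModelZd (ZdIdx)
open B9SupplySockB9P3ZdLetters (OpsZd)
open B9Eq327GreenZd (RegularAt)
open B9Eq327GreenZdHerm (RegularAtH HermPreservingAt)
open B9SupplySockB9P3ZdAllLettersZd (opsAllZd)
open B9Eq316AveragingTransposeZdLevelZero (hbox0_cubeLamBP_of_eq)

variable {d : ℕ} {𝔸 : Type*} [CStarAlgebra 𝔸]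

omit [CStarAlgebra 𝔸] in
/-- in dimension `d ≥ 2` every direction has a second one. [folklore] -/
private theorem exists_ne_dir₂ (hd2 : 2 ≤ d) (μ : Fin d) : ∃ κ : Fin d, κ ≠ μ := by
  by_cases h : (μ : ℕ) = 0
  · exact ⟨⟨1, by omega⟩, fun e => by have := congrArg Fin.val e; simp [h] at this⟩
  · exact ⟨⟨0, by omega⟩, fun e => by have := congrArg Fin.val e; simp at this; omega⟩

omit [CStarAlgebra 𝔸] in
/-- agreement on the sides of the plaquettes touching `Ω₀` gives agreement on every box whose sites lie in `Ω₀` (`d ≥ 2`: a bond based in `Ω₀` touches it).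
[cite: Balaban1985RegularSpaces, p.77 (touching convention)] -/
private theorem agreeOn_of_sides {G : Type*} (hd2 : 2 ≤ d) {Ω₀ : Set (Site d)} {U U' : Site d → Fin d → G}
    (hside : ∀ (y : Site d) (τ' : Fin d), SideTouches Ω₀ y τ' → U y τ' = U' y τ') {lo hi : Site d}
    (hin : ∀ x, InBox lo hi x → x ∈ Ω₀) : AgreeOn lo hi U U' := fun x κ hx _ => by
  obtain ⟨κ', hκ'⟩ := exists_ne_dir₂ hd2 κ
  exact hside x κ (sideTouches_of_bondTouches hκ' (Or.inl (hin x hx)))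

/-- the fine block under a level-`j` site of `□_j^{(j)}` lies in `□₀` (`□_j` is a union of `Lʲ`-blocks, `□_j ⊂ □₀`). [cite: Balaban1985RegularSpaces, (1.131) p.99, p.98] -/
private theorem block_corner_mem_cube_zero {L : ℕ} (hL : 1 ≤ L) (a : Site d) (Mc ρ : ℕ) {k j : ℕ} (hj : j ≤ k) {y : Site d}
    (hy : InBox (sqLo L a ρ k j) (sqHi L a Mc ρ k j) y) {z : Site d} (hz : Under L j y z) : z ∈ cube L a Mc ρ k 0 :=
  cube_anti (Nat.zero_le j) hj ((mem_cube_iff hL).2 ⟨y, hy, hz⟩)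

variable (τ : 𝔸 →ₗ[ℂ] ℂ) [FiniteDimensional ℝ 𝔸] {L : ℕ}

/-- ★★★ **AT A CUBE MEMBER, `RegularAtH` ∕ `RegularAt` ∕ `HermPreservingAt` ∕ THE FORM OF THE FOUR-LETTER RECORD AT PRINT'S CLASS READ THE BACKGROUND ON THE
SIDES OF THE PLAQUETTES TOUCHING `□₀` ONLY** (`Ω = cubeFam false …`, `Λs = cubeLamS …`, class `cubeLamBP`, `m ≤ k`, `2 ≤ d`, `2 ≤ L ≤ ρ`): two backgrounds
agreeing on `SideTouches (i.Ω 0)` — p. 77's reading of «`U₀` on the bonds of `Ω₀`» for the plaquette conditions — have the same predicates and the same form.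
This is the (L) input of the layer-gauge schema `B8LayerAxialGauge.of_touching_plaquettes` for these `P`, at `{y | InBox sqLo₀ sqHi₀ y} = i.Ω 0`.
[cite: Balaban1985BackgroundPropagators, (3.26)–(3.27) p.395, Thm 3.11 p.416; Balaban1985RegularSpaces, (1.131) p.99, p.77; Balaban1985Averaging, p.24 (locality)] -/
theorem regular_opsAllZd_congr_cube_sides (hd2 : 2 ≤ d) (hL : 2 ≤ L) (ops₀ : ℝ → ZdIdx d L → ℕ → OpsZd d 𝔸) (M : ℝ) (i : ZdIdx d L)
    {a : Site d} {Mc ρ : ℕ} (hρ : L ≤ ρ) (hΩ : i.Ω = cubeFam false L a Mc ρ i.k) (hΛs : i.Λs = cubeLamS L a Mc ρ i.k)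
    (hfin : (i.Ω 0).Finite) {m : ℕ} (hm : m ≤ i.k) {U₀ U₀' : Site d → Fin d → 𝔸ˣ}
    (hside : ∀ (y : Site d) (τ' : Fin d), SideTouches (i.Ω 0) y τ' → U₀ y τ' = U₀' y τ') :
    (RegularAtH i.η (opsAllZd τ L (cubeLamBP L a Mc ρ i.k) ops₀ M i m) (i.Ω 0) U₀ ↔
        RegularAtH i.η (opsAllZd τ L (cubeLamBP L a Mc ρ i.k) ops₀ M i m) (i.Ω 0) U₀') ∧
      (RegularAt i.η (opsAllZd τ L (cubeLamBP L a Mc ρ i.k) ops₀ M i m) (i.Ω 0) U₀ ↔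
        RegularAt i.η (opsAllZd τ L (cubeLamBP L a Mc ρ i.k) ops₀ M i m) (i.Ω 0) U₀') ∧
      (HermPreservingAt i.η (opsAllZd τ L (cubeLamBP L a Mc ρ i.k) ops₀ M i m) (i.Ω 0) U₀ ↔
        HermPreservingAt i.η (opsAllZd τ L (cubeLamBP L a Mc ρ i.k) ops₀ M i m) (i.Ω 0) U₀') ∧
      (∀ A ∈ B9Eq327GreenZd.domSub (𝔸 := 𝔸) (i.Ω 0),
        B9Eq327GreenZd.bondPair τ A (B9SupplySockB9P3ZdLetters.deltaAOf i.η (opsAllZd τ L (cubeLamBP L a Mc ρ i.k) ops₀ M i m) U₀ A) =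
          B9Eq327GreenZd.bondPair τ A (B9SupplySockB9P3ZdLetters.deltaAOf i.η (opsAllZd τ L (cubeLamBP L a Mc ρ i.k) ops₀ M i m) U₀' A)) := by
  have hL1 : 1 ≤ L := le_trans (by norm_num) hL
  -- `□_j ⊂ □₀ = Ω₀`
  have hcube0 : ∀ {x : Site d}, x ∈ cube L a Mc ρ i.k 0 → x ∈ i.Ω 0 := fun {x} hx => by
    rw [hΩ, cubeFam_false_zero]; exact hx
  refine B9Eq326DeltaALocalityZdSides.regular_opsAllZd_congr_sides τ hd2 hL1 _ ops₀ M i m hfin hside (fun j hj y hy => ?_)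
    (fun j hj1 hj c hc => ?_)
  · -- the block towers under the `Λ_j`-sites lie in `□₀`
    rw [hΛs] at hy
    have hyb := inBox_sq_of_mem_cubeLamS hy
    have hjk : j ≤ i.k := hj.trans hm
    have hcorner : ∀ z : Site d, Under L j y z → z ∈ i.Ω 0 := fun z hz => hcube0 (block_corner_mem_cube_zero hL1 a Mc ρ hjk hyb hz)
    refine agreeOn_of_sides hd2 hside fun x hx => hcorner x fun i' => ?_
    have h1 := (hx i').1; have h2 := (hx i').2
    simp only [blockBase, Pi.add_apply, Pi.smul_apply, Pi.one_apply, smul_eq_mul, mul_one] at h1 h2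
    push_cast at h1 h2
    constructor <;> nlinarith
  · -- the boxes of the class bonds of level `j ≥ 1` lie in `Ω_{j−1} ⊂ □₀`
    have hsub := hbox0_cubeLamBP_of_eq hL1 i a Mc hρ hΩ hm j hj1 hj c hc
    have hjk : j - 1 ≤ i.k := by omega
    refine agreeOn_of_sides hd2 hside fun x hx => ?_
    have h := hsub x hx
    rw [hΩ, cubeFam_false_of_le L a Mc ρ hjk] at h
    exact hcube0 (cube_anti (Nat.zero_le _) hjk h)

end Cube

end Literature.MathematicalPhysics.QuantumFieldTheory.Balaban1983to89.B9Eq326DeltaALocalityZdSides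

end
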